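import Summits.SmoothPoincare4.SmoothPoincare4.Theses.SymplecticOrigami
import Literature.Topology.FourManifolds.RegularLevelCollar
import Literature.AlgebraicTopology.SingularHomology.CechTautness
import Literature.AlgebraicTopology.SingularHomology.CechDualityCompact
import Literature.AlgebraicTopology.SingularHomology.RelativeCapProduct
import Literature.AlgebraicTopology.SingularHomology.NoncompactManifoldProofs

/-!
# Stub `stub_pinch_alexander` of line `pair-rigidity-endgame`, part 1: collar homotopies, duality

Helpers for the Alexander-duality stub of the pinch decomposition (crux
`SymplecticOrigami.OrigamiRung`, file `SymplecticOrigamiOrigamiRungStubPinchAlexander.lean`),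
for a smooth `τ` on a compact boundaryless `4`-manifold with a unit-speed collar field `U` across
the level `0` (`LevelUnitField`, Milnor 1963 Thm. 3.1: flow `U.fl`, clock `τ (U.fl x t) = τ x + t`
in the band `τ⁻¹(-δ, δ)`, drop `U.drop`).  `PinchFlow.*`: the *push to height `c`*,
`x ↦ U.fl x (s · max(0, c - τ x))`; the inclusion `{τ > 0} ↪ T` is a homotopy equivalence for
every `τ`-upper `T ⊆ {τ > -δ}` (`nonempty_posHomotopyEquiv`); the compact set `{τ ≥ 0}` carries
a tautness datum `Cech.RetractionNhds` (`nonempty_retractionNhds`: `{τ > -δ}` retracts onto it by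
the push to height `0` and the cofinal superlevel sets `{τ > -ε}` deform into it); the level is a
deformation retract of every thin band `{-ε < τ < ε}`, `ε ≤ δ` (`nonempty_levelHomotopyEquiv`).
`PinchHomology.*`: bookkeeping over a field `F` — two steps of the exact sequence of a pair
(`bijective_δ`, `isZero_of_top`); **Alexander–Čech duality as a dimension count**
`dim H_q(M, M ∖ K) = dim Hᵖ(↥K)` for compact taut `K` in an `F`-oriented `4`-manifold, `p + q = 4`
(`finrank_relativeSingularHomology_compl`: Miller Thm. 37.1 = the tree's
`CechDuality.classAlong_of_isCompact`, tautness `Cech.RetractionNhds.cechEquiv`, model comparison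
`relativeSingularHomology.concreteIso`); `H₄ = 0` for a connected open proper subset of a connected
`4`-manifold (Hatcher Prop. 3.29) and `dim H₀ = 1` for a connected open subset.  The registered
sub-goal `stub_pinch_alexander_cechSide` is the duality count along the collared side `{τ ≥ 0}`.
Everything is proved; all folklore.
-/



noncomputable section

-- the prescribed namespace `Summit.<P>.<Sub>.…` duplicates `SmoothPoincare4` (P = Sub)
set_option linter.dupNamespace false

open scoped Manifold ContDiff Topology ContinuousMap
open Set

namespace Summit.SmoothPoincare4.SmoothPoincare4.Theorems.OrigamiRung.PairRigidityEndgame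

open Literature.Topology.FourManifolds Literature.AlgebraicTopology.SingularHomology

section Flow

variable {M : Type} [TopologicalSpace M] [T2Space M] [CompactSpace M]
  [ChartedSpace (EuclideanSpace ℝ (Fin 4)) M] [IsManifold (𝓡 4) ∞ M] {τ : M → ℝ}

namespace PinchFlow

/-! ### Pushing up along the collar flow: `x ↦ U.fl x (s · max(0, c - τ x))` -/

variable (U : LevelUnitField 3 τ 0)

/-- The push is jointly continuous in `(s, x)`. [folklore] -/
theorem continuous_push (c : ℝ) : Continuous fun p : ℝ × M => U.fl p.2 (p.1 * max 0 (c - τ p.2)) :=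
  U.continuous_fl.comp (continuous_snd.prodMk
    (continuous_fst.mul (continuous_const.max (continuous_const.sub
      (U.contMDiff_f.continuous.comp continuous_snd)))))

/-- Points already at height `≥ c` do not move. [folklore] -/
theorem push_of_le {c : ℝ} (s : ℝ) {x : M} (h : c ≤ τ x) : U.fl x (s * max 0 (c - τ x)) = x := by
  simp [max_eq_left (sub_nonpos.mpr h)]

/-- The clock along a push: `τ = τ x + s · max(0, c - τ x)` for `s ∈ [0, 1]`, `c < δ` and
`τ x > -δ` (Milnor's `f(φ_t(q)) = f(q) + t` inside the band). [folklore] -/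
theorem apply_push {c : ℝ} (hc : c < U.δ) {s : ℝ} (hs : s ∈ Icc (0 : ℝ) 1) {x : M}
    (hx : -U.δ < τ x) : τ (U.fl x (s * max 0 (c - τ x))) = τ x + s * max 0 (c - τ x) := by
  rcases le_or_gt c (τ x) with h | h
  · rw [push_of_le U s h, max_eq_left (sub_nonpos.mpr h), mul_zero, add_zero]
  · have hm : max 0 (c - τ x) = c - τ x := max_eq_right (sub_nonneg.mpr h.le)
    rw [hm]
    refine U.apply_fl_eq_add_of_nonneg (mul_nonneg hs.1 (sub_nonneg.mpr h.le)) (by linarith) ?_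
    have : s * (c - τ x) ≤ c - τ x := by nlinarith [hs.1, hs.2, sub_nonneg.mpr h.le]
    linarith

/-- The push does not decrease `τ`. [folklore] -/
theorem le_apply_push {c : ℝ} (hc : c < U.δ) {s : ℝ} (hs : s ∈ Icc (0 : ℝ) 1) {x : M}
    (hx : -U.δ < τ x) : τ x ≤ τ (U.fl x (s * max 0 (c - τ x))) := by
  rw [apply_push U hc hs hx]
  nlinarith [hs.1, le_max_left 0 (c - τ x)]

/-- At time `1` the push reaches height `max (τ x) c`. [folklore] -/
theorem apply_push_one {c : ℝ} (hc : c < U.δ) {x : M} (hx : -U.δ < τ x) :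
    τ (U.fl x (1 * max 0 (c - τ x))) = max (τ x) c := by
  rw [apply_push U hc ⟨zero_le_one, le_rfl⟩ hx, one_mul]
  rcases le_or_gt c (τ x) with h | h
  · rw [max_eq_left (sub_nonpos.mpr h), max_eq_left h, add_zero]
  · rw [max_eq_right (sub_nonneg.mpr h.le), max_eq_right h.le]; ring

section Upper

variable {T : Set M} (hT : T ⊆ {x | -U.δ < τ x}) (hTup : ∀ ⦃x⦄, x ∈ T → ∀ ⦃y⦄, τ x ≤ τ y → y ∈ T)
include hT hTup

/-- A `τ`-upper subset of `{τ > -δ}` is stable under the pushes. [folklore] -/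
theorem push_mem {c : ℝ} (hc : c < U.δ) {s : ℝ} (hs : s ∈ Icc (0 : ℝ) 1) {x : M} (hx : x ∈ T) :
    U.fl x (s * max 0 (c - τ x)) ∈ T :=
  hTup hx (le_apply_push U hc hs (hT hx))

/-- On a `τ`-upper subset of `{τ > -δ}` the identity is homotopic to the time-`1` push to any
height `c < δ`, through the pushes. [folklore] -/
theorem homotopic_push {c : ℝ} (hc : c < U.δ) :
    (ContinuousMap.id ↥T).Homotopic
      ⟨fun x => ⟨U.fl x (1 * max 0 (c - τ x)), push_mem U hT hTup hc ⟨zero_le_one, le_rfl⟩ x.2⟩,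
        (((continuous_push U c).comp (continuous_const.prodMk continuous_id)).comp
          continuous_subtype_val).subtype_mk _⟩ :=
  ⟨{ toFun := fun p => ⟨U.fl p.2 (p.1 * max 0 (c - τ p.2)),
        push_mem U hT hTup hc ⟨p.1.2.1, p.1.2.2⟩ p.2.2⟩
     continuous_toFun := ((continuous_push U c).comp
       ((continuous_subtype_val.comp continuous_fst).prodMk
         (continuous_subtype_val.comp continuous_snd))).subtype_mk _
     map_zero_left := fun x => by ext; simp
     map_one_left := fun x => by ext; rfl }⟩

/-- **Pushing in along the flow is a homotopy equivalence**: for a `τ`-upper set `T` with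
`{τ > 0} ⊆ T ⊆ {τ > -δ}`, the inclusion `{τ > 0} ↪ T` is a homotopy equivalence, with inverse
the push to height `δ / 2` (both composites are joined to the identity by the pushes). [folklore] -/
theorem nonempty_posHomotopyEquiv (hVT : {x | 0 < τ x} ⊆ T) : Nonempty (↥{x : M | 0 < τ x} ≃ₕ ↥T) := by
  have hc : U.δ / 2 < U.δ := half_lt_self U.δ_pos
  have hV : {x : M | 0 < τ x} ⊆ {x | -U.δ < τ x} := fun x (hx : 0 < τ x) =>
    show -U.δ < τ x by linarith [U.δ_pos]
  have hVup : ∀ ⦃x⦄, x ∈ {x : M | 0 < τ x} → ∀ ⦃y⦄, τ x ≤ τ y → y ∈ {x : M | 0 < τ x} :=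
    fun x (hx : 0 < τ x) y hxy => lt_of_lt_of_le hx hxy
  exact
   ⟨{ toFun := ContinuousMap.inclusion hVT
      invFun := ⟨fun x => ⟨U.fl x (1 * max 0 (U.δ / 2 - τ x)), lt_of_lt_of_le (half_pos U.δ_pos)
          (by rw [apply_push_one U hc (hT x.2)]; exact le_max_right _ _)⟩,
        (((continuous_push U _).comp (continuous_const.prodMk continuous_id)).comp
          continuous_subtype_val).subtype_mk _⟩
      left_inv := (homotopic_push U hV hVup hc).symm
      right_inv := (homotopic_push U hT hTup hc).symm }⟩

end Upper

/-! ### Tautness of `{τ ≥ 0}` -/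

omit [ChartedSpace (EuclideanSpace ℝ (Fin 4)) M] [IsManifold (𝓡 4) ∞ M] [T2Space M] in
/-- The open superlevel sets `{τ > -ε}`, `0 < ε < δ`, are cofinal among the open neighbourhoods
of the compact set `{τ ≥ 0}` (on the compact complement of such a neighbourhood `τ` is bounded
away from `0`). [folklore] -/
theorem exists_superlevel_subset (hτ : Continuous τ) {δ : ℝ} (hδ : 0 < δ) {O : Set M}
    (hO : IsOpen O) (hWO : {x | 0 ≤ τ x} ⊆ O) :
    ∃ ε, 0 < ε ∧ ε < δ ∧ {x | -ε < τ x} ⊆ O := by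
  rcases eq_empty_or_nonempty Oᶜ with h | h
  · refine ⟨δ / 2, half_pos hδ, half_lt_self hδ, ?_⟩
    rw [compl_empty_iff.mp h]; exact subset_univ _
  · obtain ⟨x₀, hx₀, hmax⟩ := hO.isClosed_compl.isCompact.exists_isMaxOn h hτ.continuousOn
    have h0 : τ x₀ < 0 := lt_of_not_ge fun h' => hx₀ (hWO h')
    refine ⟨min (δ / 2) (-τ x₀ / 2), lt_min (half_pos hδ) (by linarith),
      lt_of_le_of_lt (min_le_left _ _) (half_lt_self hδ), fun x hx => ?_⟩
    by_contra hxO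
    have h1 : τ x ≤ τ x₀ := hmax hxO
    have h2 : -min (δ / 2) (-τ x₀ / 2) < τ x := hx
    linarith [min_le_right (δ / 2) (-τ x₀ / 2)]

/-- **Tautness datum for `{τ ≥ 0}`** from the collar flow (Spanier's hypothesis of Thm. 6.1.10,
the tree's `Cech.RetractionNhds`): `U₀ = {τ > -δ}` retracts onto `{τ ≥ 0}` by the time-`1`
push to height `0`, and every open `O ⊇ {τ ≥ 0}` inside `U₀` contains a superlevel set
`{τ > -ε}` on which the pushes join the inclusion to the retraction. [folklore] -/
theorem nonempty_retractionNhds (U : LevelUnitField 3 τ 0) :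
    Nonempty (Cech.RetractionNhds {x : M | 0 ≤ τ x}) :=
  ⟨{ U₀ := {x | -U.δ < τ x}
     isOpen := isOpen_lt continuous_const U.contMDiff_f.continuous
     subset := fun x (hx : 0 ≤ τ x) => show -U.δ < τ x by linarith [U.δ_pos]
     r := ⟨fun x => ⟨U.fl x (1 * max 0 (0 - τ x)), show 0 ≤ τ (U.fl x (1 * max 0 (0 - τ x))) by
         rw [apply_push_one U U.δ_pos x.2]; exact le_max_right _ _⟩,
       (((continuous_push U 0).comp (continuous_const.prodMk continuous_id)).comp
          continuous_subtype_val).subtype_mk _⟩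
     retract := fun x hx => Subtype.ext (push_of_le U 1 hx)
     homotopic := fun O hO hKO hOU₀ => by
       obtain ⟨ε, hε, hεδ, hVO⟩ :=
         exists_superlevel_subset U.contMDiff_f.continuous U.δ_pos hO hKO
       refine ⟨{x | -ε < τ x}, isOpen_lt continuous_const U.contMDiff_f.continuous,
         fun x (hx : 0 ≤ τ x) => show -ε < τ x by linarith, hVO, ?_⟩
       have hV : {x : M | -ε < τ x} ⊆ {x | -U.δ < τ x} := fun x (hx : -ε < τ x) =>
         show -U.δ < τ x by linarith
       have hVup : ∀ ⦃x⦄, x ∈ {x : M | -ε < τ x} → ∀ ⦃y⦄, τ x ≤ τ y → y ∈ {x : M | -ε < τ x} :=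
         fun x (hx : -ε < τ x) y hxy => lt_of_lt_of_le hx hxy
       exact (ContinuousMap.Homotopic.refl (ContinuousMap.inclusion hVO)).comp
         (homotopic_push U hV hVup U.δ_pos) }⟩

/-! ### The thin band deformation retracts onto the level -/

section Band

variable {ε : ℝ} (hε : 0 < ε) (hεδ : ε ≤ U.δ)
include hεδ

omit [T2Space M] [CompactSpace M] in
/-- A thin band `{-ε < τ < ε}`, `ε ≤ δ`, lies in Milnor's open band of the unit field. [folklore] -/
theorem mem_band_of_mem {x : M} (hx : x ∈ ({x : M | τ x < ε} ∩ {x | -ε < τ x})) : x ∈ U.band := by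
  have hx1 : τ x < ε := hx.1
  have hx2 : -ε < τ x := hx.2
  exact ⟨by linarith, by linarith⟩

/-- The clock along the radial deformation: `τ (φ_{-s τ x}(x)) = (1 - s) τ x` on the thin band.
[folklore] -/
theorem apply_fl_neg_mul {x : M} (hx : x ∈ ({x : M | τ x < ε} ∩ {x | -ε < τ x})) {s : ℝ}
    (hs : s ∈ Icc (0 : ℝ) 1) : τ (U.fl x (-(s * τ x))) = τ x - s * τ x := by
  have hx1 : τ x < ε := hx.1
  have hx2 : -ε < τ x := hx.2
  have h1 : τ x + -(s * τ x) ∈ Ioo (0 - U.δ) (0 + U.δ) := by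
    constructor <;> rcases le_or_gt 0 (τ x) with h | h <;> nlinarith [hs.1, hs.2]
  rw [U.apply_fl_eq_add (mem_band_of_mem U hεδ hx) h1]; ring

/-- The thin band is stable under the radial deformation. [folklore] -/
theorem fl_neg_mul_mem {x : M} (hx : x ∈ ({x : M | τ x < ε} ∩ {x | -ε < τ x})) {s : ℝ}
    (hs : s ∈ Icc (0 : ℝ) 1) : U.fl x (-(s * τ x)) ∈ ({x : M | τ x < ε} ∩ {x | -ε < τ x}) := by
  have hx1 : τ x < ε := hx.1
  have hx2 : -ε < τ x := hx.2
  refine ⟨show τ (U.fl x (-(s * τ x))) < ε from ?_, show -ε < τ (U.fl x (-(s * τ x))) from ?_⟩ <;>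
    rw [apply_fl_neg_mul U hεδ hx hs] <;> rcases le_or_gt 0 (τ x) with h | h <;> nlinarith [hs.1, hs.2]

/-- The drop `ψ_y(0) = φ_{-τ y}(y)` maps the thin band into itself (indeed onto the level).
[folklore] -/
theorem drop_mem {x : M} (hx : x ∈ ({x : M | τ x < ε} ∩ {x | -ε < τ x})) :
    U.drop x ∈ ({x : M | τ x < ε} ∩ {x | -ε < τ x}) := by
  simpa [LevelUnitField.drop] using fl_neg_mul_mem U hεδ hx (s := 1) ⟨zero_le_one, le_rfl⟩

/-- **The radial deformation of the thin band onto the level**, `(s, x) ↦ φ_{-s τ(x)}(x)`: the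
identity of the band is homotopic to Milnor's drop. [folklore] -/
theorem homotopic_drop :
    (ContinuousMap.id ↥({x : M | τ x < ε} ∩ {x | -ε < τ x})).Homotopic
      ⟨fun x => ⟨U.drop x, drop_mem U hεδ x.2⟩,
        (U.continuous_drop.comp continuous_subtype_val).subtype_mk _⟩ := by
  refine ⟨{ toFun := fun p => ⟨U.fl p.2 (-(p.1 * τ p.2)), fl_neg_mul_mem U hεδ p.2.2 ⟨p.1.2.1, p.1.2.2⟩⟩
            continuous_toFun := ?_
            map_zero_left := fun x => ?_
            map_one_left := fun x => ?_ }⟩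
  · refine Continuous.subtype_mk ?_ _
    exact U.continuous_fl.comp ((continuous_subtype_val.comp continuous_snd).prodMk
      (((continuous_subtype_val.comp continuous_fst).mul
        (U.contMDiff_f.continuous.comp (continuous_subtype_val.comp continuous_snd))).neg))
  · ext
    change U.fl x (-(0 * τ x)) = x
    simp
  · ext
    change U.fl x (-(1 * τ x)) = U.fl x (0 - τ x)
    rw [one_mul, zero_sub]

include hε in
/-- **The level is a deformation retract of a thin band**: for `0 < ε ≤ δ` the inclusion
`{τ = 0} ↪ {-ε < τ < ε}` is a homotopy equivalence with inverse Milnor's drop `ψ_y(0)` along the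
flow. [folklore] -/
theorem nonempty_levelHomotopyEquiv :
    Nonempty (↥{x : M | τ x = 0} ≃ₕ ↥({x : M | τ x < ε} ∩ {x | -ε < τ x})) :=
  ⟨{ toFun := ContinuousMap.inclusion fun x (hx : τ x = 0) =>
       ⟨show τ x < ε by linarith [hx], show -ε < τ x by linarith⟩
     invFun := ⟨fun x => ⟨U.drop x, U.apply_drop (mem_band_of_mem U hεδ x.2)⟩,
       (U.continuous_drop.comp continuous_subtype_val).subtype_mk _⟩
     left_inv := ⟨(ContinuousMap.Homotopy.refl _).cast (by
       ext x; exact congrArg Subtype.val (Subtype.ext (U.drop_of_apply_eq x.2).symm :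
         x = ⟨U.drop x, _⟩)) rfl⟩
     right_inv := (homotopic_drop U hεδ).symm }⟩

end Band

end PinchFlow

end Flow

open CategoryTheory CategoryTheory.Limits

namespace PinchHomology

/-! ### Two steps in the exact sequence of a pair -/

section LES

variable (F : Type) [Field F] {X : Type} [TopologicalSpace X] (A : Set X)

/-- In the exact sequence of the pair `(X, A)`: if `Hₙ₊₁(X) = 0 = Hₙ₊₂(X)` then
`∂ : Hₙ₊₂(X, A) → Hₙ₊₁(A)` is bijective (Hatcher Thm. 2.16). [folklore] -/
theorem bijective_δ (n : ℕ) (h₁ : IsZero (singularHomology F F X (n + 1)))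
    (h₂ : IsZero (singularHomology F F X (n + 2))) :
    Function.Bijective (relativeSingularHomology.δ F F X A (n + 1)) := by
  constructor
  · have hm : Mono (relativeSingularHomology.δ F F X A (n + 1)) :=
      (relativeSingularHomology.exact_ofAbsolute_δ F F (X := X) A (n + 1)).mono_g (h₂.eq_of_src _ _)
    exact (ModuleCat.mono_iff_injective _).mp hm
  · have he : Epi (relativeSingularHomology.δ F F X A (n + 1)) :=
      (relativeSingularHomology.exact_δ_map F F (X := X) A (n + 1)).epi_f (h₁.eq_of_tgt _ _)
    exact (ModuleCat.epi_iff_surjective _).mp he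

/-- In the exact sequence of the pair `(X, A)`: if `Hₙ₊₁(A) = 0`, `Hₙ(X) = 0` and `Hₙ₊₁(X)`,
`Hₙ₊₁(X, A)` are one-dimensional, then `Hₙ(A) = 0` (`Hₙ₊₁(X) ↪ Hₙ₊₁(X, A)` is then onto, so
`∂ = 0`, while `∂` is onto). [folklore] -/
theorem isZero_of_top (n : ℕ) (hA : IsZero (singularHomology F F ↥A (n + 1)))
    (hX : IsZero (singularHomology F F X n))
    (hX' : Module.finrank F (singularHomology F F X (n + 1)) = 1)
    (hXA : Module.finrank F (relativeSingularHomology F F X A (n + 1)) = 1) :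
    IsZero (singularHomology F F ↥A n) := by
  -- `j_* : Hₙ₊₁(X) → Hₙ₊₁(X, A)` is injective, hence (equal finite dimensions) surjective
  have hm : Mono (relativeSingularHomology.ofAbsolute F F X A (n + 1)) :=
    (relativeSingularHomology.exact_map_ofAbsolute F F (X := X) A (n + 1)).mono_g (hA.eq_of_src _ _)
  have hinj := (ModuleCat.mono_iff_injective _).mp hm
  haveI : Module.Finite F (singularHomology F F X (n + 1)) := Module.finite_of_finrank_eq_succ hX'
  haveI : Module.Finite F (relativeSingularHomology F F X A (n + 1)) :=
    Module.finite_of_finrank_eq_succ hXA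
  have hsurj : Function.Surjective (relativeSingularHomology.ofAbsolute F F X A (n + 1)) :=
    (LinearMap.injective_iff_surjective_of_finrank_eq_finrank (hX'.trans hXA.symm)).mp hinj
  haveI : Epi (relativeSingularHomology.ofAbsolute F F X A (n + 1)) :=
    (ModuleCat.epi_iff_surjective _).mpr hsurj
  have hδ0 : relativeSingularHomology.δ F F X A n = 0 :=
    zero_of_epi_comp (relativeSingularHomology.ofAbsolute F F X A (n + 1))
      (relativeSingularHomology.ofAbsolute_comp_δ F F A n)
  haveI : Epi (relativeSingularHomology.δ F F X A n) :=
    (relativeSingularHomology.exact_δ_map F F (X := X) A n).epi_f (hX.eq_of_tgt _ _)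
  exact IsZero.of_epi_eq_zero _ hδ0

end LES

/-! ### Čech duality read through a tautness datum; the homology of a non-compact side -/

section Cech

variable (F : Type) [Field F] {M : Type} [TopologicalSpace M] [T2Space M]
  [ChartedSpace (EuclideanSpace ℝ (Fin 4)) M]

/-- **Alexander–Čech duality, dimension count**: for an `F`-oriented `4`-manifold `M`, a compact
`K ⊆ M` with a tautness datum, and `p + q = 4`,
`dim_F H_q(M, M ∖ K; F) = dim_F Hᵖ(↥K; F)` — Miller's Thm. 37.1 (`Ȟᵖ(K) ≅ H_q(M | K)`, the
tree's `CechDuality.classAlong_of_isCompact`) composed with tautness (`Ȟᵖ(K) ≅ Hᵖ(↥K)`,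
`Cech.RetractionNhds.cechEquiv`) and the comparison of the two models of relative homology.
[folklore] -/
theorem finrank_relativeSingularHomology_compl (μ : HomologicalOrientation F M 4) {K : Set M}
    (hK : IsCompact K) (T : Cech.RetractionNhds K) {p q : ℕ} (h : p + q = 4) :
    Module.finrank F (relativeSingularHomology F F M Kᶜ q) =
      Module.finrank F (singularCohomology F F ↥K p) := by
  have hD := CechDuality.classAlong_of_isCompact (by norm_num : 1 ≤ 4) μ hK p q h
  have e₁ : relativeSingularHomology F F M Kᶜ q ≃ₗ[F] clocalHomology F F M K q :=
    (relativeSingularHomology.concreteIso F F M Kᶜ q).toLinearEquiv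
  have e₂ := LinearEquiv.ofBijective _ hD
  have e₃ := T.cechEquiv (R := F) p
  rw [e₁.finrank_eq, ← e₂.finrank_eq]
  exact e₃.finrank_eq

/-- A connected open proper subset of a connected `4`-manifold has `H₄ = 0`: it is a connected
NON-compact `4`-manifold (a compact open subset would be clopen), Hatcher Prop. 3.29
(`isZero_singularHomology_of_noncompactSpace_holds`). [folklore] -/
theorem isZero_singularHomology_four_of_isOpen [PreconnectedSpace M] {O : Set M} (hO : IsOpen O)
    (hOc : IsConnected O) (hne : O ≠ univ) : IsZero (singularHomology F F ↥O 4) := by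
  let O' : TopologicalSpace.Opens M := ⟨O, hO⟩
  haveI : ConnectedSpace ↥O' := isConnected_iff_connectedSpace.mp hOc
  haveI : NoncompactSpace ↥O' := by
    refine not_compactSpace_iff.mp fun hc => ?_
    have hK : IsCompact O := isCompact_iff_compactSpace.mpr hc
    rcases isClopen_iff.mp ⟨hK.isClosed, hO⟩ with h | h
    · exact hOc.nonempty.ne_empty h
    · exact hne h
  exact isZero_singularHomology_of_noncompactSpace_holds F ↥O' 4 le_rfl

omit [T2Space M] in
/-- A nonempty connected open subset of a manifold has `dim_F H₀ = 1` (path connected,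
Hatcher Prop. 2.7). [folklore] -/
theorem finrank_singularHomology_zero_of_isOpen {O : Set M} (hO : IsOpen O) (hOc : IsConnected O) :
    Module.finrank F (singularHomology F F ↥O 0) = 1 := by
  haveI := ChartedSpace.locallyPathConnectedSpace (EuclideanSpace ℝ (Fin 4)) M
  haveI : PathConnectedSpace ↥O :=
    isPathConnected_iff_pathConnectedSpace.mp ((hO.isConnected_iff_isPathConnected).mp hOc)
  haveI := singularHomology.isIso_ε_of_pathConnectedSpace F F (X := ↥O)
  rw [((asIso (singularHomology.ε F F ↥O)).toLinearEquiv.trans ULift.moduleEquiv).finrank_eq,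
    Module.finrank_self]

end Cech

end PinchHomology

/-! ### Registered sub-goal -/

/-- **Registered sub-goal (explicit binders, universe `0`)**: Čech–Alexander duality along the
collared compact side `W = {τ ≥ 0}` of a level carrying a unit-speed collar field, on an
`F`-oriented compact `4`-manifold: `dim_F H_q(M, M ∖ W; F) = dim_F Hᵖ(↥W; F)` for `p + q = 4`
(`PinchHomology.finrank_relativeSingularHomology_compl` with the tautness datum
`PinchFlow.nonempty_retractionNhds`). [folklore] -/
theorem stub_pinch_alexander_cechSide :
    ∀ (M : Type) [TopologicalSpace M] [T2Space M] [CompactSpace M]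
      [ChartedSpace (EuclideanSpace ℝ (Fin 4)) M] [IsManifold (𝓡 4) ∞ M] (F : Type) [Field F]
      (μ : Literature.AlgebraicTopology.SingularHomology.HomologicalOrientation F M 4) (τ : M → ℝ),
      Nonempty (Literature.Topology.FourManifolds.LevelUnitField 3 τ 0) →
      ∀ (p q : ℕ), p + q = 4 →
        Module.finrank F (Literature.AlgebraicTopology.SingularHomology.relativeSingularHomology F F
            M {x : M | 0 ≤ τ x}ᶜ q) =
          Module.finrank F (Literature.AlgebraicTopology.SingularHomology.singularCohomology F F
            ↥{x : M | 0 ≤ τ x} p) :=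
  fun _ _ _ _ _ _ F _ μ _ hU _ _ h => by
    obtain ⟨U⟩ := hU
    obtain ⟨T⟩ := PinchFlow.nonempty_retractionNhds U
    exact PinchHomology.finrank_relativeSingularHomology_compl F μ
      (isClosed_le continuous_const U.contMDiff_f.continuous).isCompact T h

end Summit.SmoothPoincare4.SmoothPoincare4.Theorems.OrigamiRung.PairRigidityEndgame

end
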